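import Summits.QuantumFields.YangMills.Theorems.LuscherReductionDressedRitzLiftLeakageClosingKinematic
import HarnessLib

/-!
# Crux `DressedRitz` (stmt-QuantumFields-20205), line «polyakovlift» r5, stub S-LEAK `stub_liftLeakage` — support XVI:
# the located core of S-LEAK as a NAMED target `SlowOutsideLawAt k`, and the service lemma that supplies the fine eigenfamily

Support module (fleet seat ym-20205-polyakovlift-s1 gen 1; `--supports stmt-QuantumFields-20205`, helper, no closure claim).  Like the lead's named cores
for the other three stubs of the line (`SlabChannelUniversalityAt`, `ShadowBudgetAt`, infvol-p1's `GramUniversalityAt`), this file gives S-LEAK's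
renormalisation-group core a NAME, so that the crux map, the disprover and the ideation seats can cite ∕ attack it:

* `SlowOutsideLawAt k` := the hypothesis of XV `LiftLeak.liftLeakage_dressed_of_slowOutsideLaw` at level `k` — per lattice point of the femto window, at the
  Perron–Frobenius vacuum: reference one-site data at `B₁`; one exact fine eigenfamily; per reference lift an own fine index and a slow set with
  (SLOW) `Σ_{j∈S}(μ_j − μ_{j₀})²μ_j^{2L}⟨x_n,χ_j⟩² ≤ C₁(λ³/L²)λ₀²·μ_{j₀}^{2L}·⟨x_n,χ_{j₀}⟩²` and (OUT) `‖x_n‖² − Σ_{j∈S}⟨x_n,χ_j⟩² ≤ C₂λ³·⟨x_n,χ_{j₀}⟩²`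
  (`x_n = liftVec β Ω (ψ_n/Ω₁)` UNDRESSED); (CW) width `δ`; (GR) in-level Gram `γ`; rates `4N((C₁+C₂)(λ³/L²)λ₀² + δ²) ≤ C(λ³/L²)λ₀²`, `Nγ ≤ 1/2`;
* ★★★ `liftLeakage_of_slowOutsideLaw : (∀ k, SlowOutsideLawAt k) →` the r5 text of `Stmt.stub_liftLeakage` VERBATIM;
* `exists_eigenfamily_below` — SERVICE: for `β > 0`, any `J`, `m`: the tree supplies an exact physical orthonormal eigenfamily `χ_0 … χ_{M−1}` (levels
  `levelValue j`, `M > J`) dominating at `Λ = levelValue M` with `0 ≤ Λ ≤ levelValue J` and `(m+1)²Λ^{2m} ≤ (levelValue J)^{2m}` — i.e. the fine-family,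
  domination and gap slots of `SlowOutsideLawAt` are FREE (discreteness `levelValue M → 0`, `FemtoTransferGapLevelsDecay`); what is open is (SLOW), (OUT),
  and the same-type residues of (CW)/(GR) (see XIII `…LiftLeakageSymmetry.lean`).

HONEST FRAMING: a definition + plumbing at fixed lattice on the conditional femto rung R2b1; `stub_liftLeakage` stays OPEN (its content is `SlowOutsideLawAt`,
an open renormalisation-group ∕ Born–Oppenheimer estimate, not in print); nothing here bears on infinite volume, the continuum limit or the Clay gap.
References: M. Lüscher, NPB 219 (1983) 233 [cite: Luscher1983, §3]; M. Lüscher, U. Wolff, NPB 339 (1990) 222 [cite: LuscherWolff1990, §2];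
M. Reed, B. Simon IV (1978) Thm XIII.1 [cite: ReedSimonIV1978].
-/

set_option autoImplicit false

noncomputable section

open MeasureTheory Filter Topology Finset
open Literature.MathematicalPhysics.QuantumFieldTheory
open Literature.MathematicalPhysics.QuantumLattice
open scoped BigOperators

namespace Summit.QuantumFields.YangMills.Theorems.FemtoTransferGap.LiftLeak

open Summit.QuantumFields.YangMills.Theorems.FemtoTransferGap
open Summit.QuantumFields.YangMills.Theorems.FemtoTransferGap.PolyakovLift
open Summit.QuantumFields.YangMills.Theorems.FemtoTransferGap.VacDict

/-! ## §1 Service: the fine eigenfamily with the kinematic gap is supplied by the tree -/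

section Service

variable {L : ℕ} [NeZero L]

/-- ★ **The fine-family slots are free.**  For `β > 0`, every `J` and `m` there is an exact physical `l2`-orthonormal eigenfamily `χ_0 … χ_{M−1}` of
`K_β` with `M > J`, levels `levelValue j`, dominating at `Λ = levelValue M`, with `0 ≤ Λ ≤ levelValue J` and `(m+1)²·Λ^{2m} ≤ (levelValue J)^{2m}`
(discreteness of the zero-flux transfer spectrum). [cite: ReedSimonIV1978, Thm XIII.1] -/
theorem exists_eigenfamily_below {β : ℝ} (hβ : 0 < β) (J m : ℕ) :
    ∃ (M : ℕ) (χ : Fin M → (GaugeConfig 3 L SU2 → ℝ)), J < M ∧ (∀ j, IsPhys (χ j)) ∧ (∀ i l, l2 (χ i) (χ l) = if i = l then 1 else 0) ∧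
      (∀ j : Fin M, transferApply β (χ j) = levelValue su2Rep L β j • χ j) ∧
      (∀ φ : GaugeConfig 3 L SU2 → ℝ, IsPhys φ → (∀ j, l2 φ (χ j) = 0) →
        l2 φ (transferApply β φ) ≤ levelValue su2Rep L β M * l2 φ φ) ∧
      0 ≤ levelValue su2Rep L β M ∧ levelValue su2Rep L β M ≤ levelValue su2Rep L β J ∧
      ((m : ℝ) + 1) ^ 2 * levelValue su2Rep L β M ^ (2 * m) ≤ levelValue su2Rep L β J ^ (2 * m) := by
  set μ := levelValue su2Rep L β J with hμ
  have hμpos : 0 < μ := levelValue_su2Rep_pos hβ J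
  have he : 0 < Real.exp 1 := Real.exp_pos 1
  have hthr : 0 < μ / Real.exp 1 := div_pos hμpos he
  have hev := (tendsto_order.1 (tendsto_levelValue_atTop_zero (L := L) hβ)).2 (μ / Real.exp 1) hthr
  obtain ⟨M₀, hM₀⟩ := eventually_atTop.mp hev
  set M := max M₀ (J + 1) with hM
  have hJM : J < M := Nat.lt_of_lt_of_le (Nat.lt_succ_self J) (le_max_right _ _)
  have hΛlt : levelValue su2Rep L β M < μ / Real.exp 1 := hM₀ M (le_max_left _ _)
  have hΛ0 : 0 ≤ levelValue su2Rep L β M := (levelValue_su2Rep_pos hβ M).le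
  obtain ⟨χ, hχ, hon, heig, hdom⟩ := exists_eigenfamily_dominating (L := L) hβ M
  refine ⟨M, χ, hJM, hχ, hon, heig, hdom, hΛ0, ?_, gap_of_le_div_exp hΛ0 hΛlt.le m⟩
  calc levelValue su2Rep L β M ≤ μ / Real.exp 1 := hΛlt.le
    _ ≤ μ := div_le_self hμpos.le (by have := Real.add_one_le_exp (1 : ℝ); linarith)

end Service

/-! ## §2 The named core and the closing implication -/

/-- **`SlowOutsideLawAt k`** — the located renormalisation-group core of S-LEAK at level `k` (hypothesis of XV `liftLeakage_dressed_of_slowOutsideLaw`):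
constants `C ≥ 0`, `lam0 > 0`; eventually in the femto window, at the Perron–Frobenius package `(Ω,θ,c)`: reference one-site data at `B₁ = liftCoupling β L`
(`Ω₁`, `ψ`, `ev`, domination `Λ₁ < μ_k(B₁)`), one exact fine eigenfamily (`χ`, `μ`, domination `Λ`), per reference lift an own index `j₀ n` and a slow set
`S n` with the kinematic side conditions and (SLOW) + (OUT) on the UNDRESSED `x_n = liftVec β Ω (ψ_n/Ω₁)`, the width (CW) and Gram (GR) conditions inside
one-site levels, and the rate inequality `4N((C₁+C₂)(λ³/L²)λ₀² + δ²) ≤ C(λ³/L²)λ₀²`, `Nγ ≤ 1/2`. [cite: Luscher1983, §3] [cite: LuscherWolff1990, §2] -/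
def SlowOutsideLawAt (k : ℕ) : Prop :=
  ∃ C lam0 : ℝ, 0 ≤ C ∧ 0 < lam0 ∧ ∀ lam : ℝ, 0 < lam → lam ≤ lam0 → ∃ L0 : ℕ,
    ∀ (L : ℕ) [NeZero L], L0 ≤ L → ∀ β : ℝ, InFemtoWindow lam β L →
      ∀ (Ω : physSubmodule L) (θ c : ℝ), IsVacuum β Ω θ → 0 < c → (∀ U, c ≤ (Ω : GaugeConfig 3 L SU2 → ℝ) U) →
        ∃ (Ω₁ : GaugeConfig 3 1 SU2 → ℝ) (N : ℕ) (ψ : Fin N → (GaugeConfig 3 1 SU2 → ℝ)) (ev : Fin N → ℝ) (Λ₁ : ℝ)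
          (M : ℕ) (χ : Fin M → (GaugeConfig 3 L SU2 → ℝ)) (μ : Fin M → ℝ) (Λ : ℝ)
          (j₀ : Fin N → Fin M) (S : Fin N → Finset (Fin M)) (δ γ C₁ C₂ : ℝ),
          IsRawVacuum (liftCoupling β L) Ω₁ ∧ (∃ c₁ : ℝ, 0 < c₁ ∧ ∀ V, c₁ ≤ Ω₁ V) ∧ (∀ n, IsPhys (ψ n)) ∧
          (∀ n n', l2 (ψ n) (ψ n') = if n = n' then 1 else 0) ∧ (∀ n, transferApply (liftCoupling β L) (ψ n) = ev n • ψ n) ∧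
          0 ≤ Λ₁ ∧ Λ₁ < levelValue su2Rep 1 (liftCoupling β L) k ∧
          (∀ ξ : GaugeConfig 3 1 SU2 → ℝ, IsPhys ξ → (∀ n, l2 ξ (ψ n) = 0) →
            l2 ξ (transferApply (liftCoupling β L) ξ) ≤ Λ₁ * l2 ξ ξ) ∧
          (∀ j, IsPhys (χ j)) ∧ (∀ j j', l2 (χ j) (χ j') = if j = j' then 1 else 0) ∧ (∀ j, transferApply β (χ j) = μ j • χ j) ∧ 0 ≤ Λ ∧
          (∀ ξ : GaugeConfig 3 L SU2 → ℝ, IsPhys ξ → (∀ j, l2 ξ (χ j) = 0) → l2 ξ (transferApply β ξ) ≤ Λ * l2 ξ ξ) ∧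
          0 ≤ C₁ ∧ 0 ≤ C₂ ∧ 0 ≤ γ ∧ (N : ℝ) * γ ≤ 1 / 2 ∧
          4 * N * ((C₁ + C₂) * (luscherLambda β L ^ 3 / (L : ℝ) ^ 2) * levelValue su2Rep L β 0 ^ 2 + δ ^ 2) ≤
            C * (luscherLambda β L ^ 3 / (L : ℝ) ^ 2) * levelValue su2Rep L β 0 ^ 2 ∧
          (∀ n, Λ ≤ μ (j₀ n) ∧ μ (j₀ n) ≤ levelValue su2Rep L β 0 ∧ (∀ j, j ∉ S n → μ j ≤ μ (j₀ n)) ∧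
            ((dressSteps L : ℝ) + 1) ^ 2 * Λ ^ (2 * dressSteps L) ≤ μ (j₀ n) ^ (2 * dressSteps L) ∧
            ∑ j ∈ S n, (μ j - μ (j₀ n)) ^ 2 * μ j ^ (2 * dressSteps L) *
                l2 (liftVec β (Ω : GaugeConfig 3 L SU2 → ℝ) (ψ n / Ω₁)) (χ j) ^ 2 ≤
              C₁ * (luscherLambda β L ^ 3 / (L : ℝ) ^ 2) * levelValue su2Rep L β 0 ^ 2 *
                (μ (j₀ n) ^ (2 * dressSteps L) * l2 (liftVec β (Ω : GaugeConfig 3 L SU2 → ℝ) (ψ n / Ω₁)) (χ (j₀ n)) ^ 2) ∧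
            l2 (liftVec β (Ω : GaugeConfig 3 L SU2 → ℝ) (ψ n / Ω₁)) (liftVec β (Ω : GaugeConfig 3 L SU2 → ℝ) (ψ n / Ω₁)) -
                ∑ j ∈ S n, l2 (liftVec β (Ω : GaugeConfig 3 L SU2 → ℝ) (ψ n / Ω₁)) (χ j) ^ 2 ≤
              C₂ * luscherLambda β L ^ 3 * l2 (liftVec β (Ω : GaugeConfig 3 L SU2 → ℝ) (ψ n / Ω₁)) (χ (j₀ n)) ^ 2) ∧
          (∀ n n', ev n = ev n' → (μ (j₀ n) - μ (j₀ n')) ^ 2 ≤ δ ^ 2) ∧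
          (∀ n n', n ≠ n' → ev n = ev n' →
            |l2 (dressedLiftVec β (Ω : GaugeConfig 3 L SU2 → ℝ) (ψ n / Ω₁)) (dressedLiftVec β (Ω : GaugeConfig 3 L SU2 → ℝ) (ψ n' / Ω₁))| ≤
              γ * (Real.sqrt (l2 (dressedLiftVec β (Ω : GaugeConfig 3 L SU2 → ℝ) (ψ n / Ω₁)) (dressedLiftVec β (Ω : GaugeConfig 3 L SU2 → ℝ) (ψ n / Ω₁))) *
                Real.sqrt (l2 (dressedLiftVec β (Ω : GaugeConfig 3 L SU2 → ℝ) (ψ n' / Ω₁))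
                  (dressedLiftVec β (Ω : GaugeConfig 3 L SU2 → ℝ) (ψ n' / Ω₁)))))

/-- ★★★ **`(∀ k, SlowOutsideLawAt k)` ⟹ the registered r5 text of `Stmt.stub_liftLeakage` VERBATIM** (XV). [cite: Luscher1983, §3] [cite: LuscherWolff1990, §2] -/
theorem liftLeakage_of_slowOutsideLaw (h : ∀ k : ℕ, SlowOutsideLawAt k) :
    ∀ k : ℕ, ∃ C lam0 : ℝ, 0 ≤ C ∧ 0 < lam0 ∧ ∀ lam : ℝ, 0 < lam → lam ≤ lam0 → ∃ L0 : ℕ,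
      ∀ (L : ℕ) [NeZero L], L0 ≤ L → ∀ β : ℝ, InFemtoWindow lam β L →
        ∀ φ : GaugeConfig 3 L SU2 → ℝ, IsRawVacuum β φ →
          ∀ (ω : GaugeConfig 3 1 SU2 → ℝ) (g : Fin k → (GaugeConfig 3 1 SU2 → ℝ)), LiftBasis (liftCoupling β L) k ω g →
            LeakageClause k C β (dressedLiftFamily β φ g) :=
  liftLeakage_dressed_of_slowOutsideLaw h

end Summit.QuantumFields.YangMills.Theorems.FemtoTransferGap.LiftLeak

end
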